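import Literature.NumberTheory.Automorphic.BigCell
import Literature.NumberTheory.Automorphic.ChevalleyIsomorphismLie
import Literature.NumberTheory.Automorphic.LieCentralizerTorusHolds
import HarnessLib

/-!
# Discharge of the named fact `nonempty_bigCellChart` (the open big cell, Springer 8.3.6 (ii),
# 8.3.11 with 8.2.1) in characteristic `0`
(trunk T-AUTOMORPHIC, G25 AutomorphicL; proof file of `BigCell.lean`)

`BigCell.lean` vendors, as the named fact `nonempty_bigCellChart`, the input to step 2 of
Springer's proof of the isomorphism theorem 9.6.2 (*Linear Algebraic Groups*, 2nd ed.): for `G`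
connected reductive over an algebraically closed field of characteristic `0`, `T` a maximal torus
with root datum `P` and root homomorphisms `u_i` of all roots, there is a `BigCellChart G T u` —
an open neighbourhood `Ω ∋ 1` of `G` (a finite union of principal opens) with regular functions
`x_i, y_i, t` on it such that `g = ∏ u_i(x_i(g)) · t(g) · ∏ u_i(y_i(g))` on `Ω` (Springer 8.3.6 (ii)
for `w = w₀`, 8.3.11: `C(w₀) = B ẇ₀ B` is open, 8.2.1: `U = ∏ U_α`). This file records the
discharge **`nonempty_bigCellChart_holds`**, assembling the chain of proved reductions already in
the tree:

1. `lieWeightSpace_one_le_lieAlgebraGL_holds` (`LieCentralizerTorusHolds.lean`; Springer 5.4.7 with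
   7.6.4 (ii)): `𝔤^T ⊆ L(T)` in characteristic `0`;
2. `posRootGroup_eq_prod_of_lieWeightSpace_one_le` (`ChevalleyIsomorphismLie.lean`; 8.2.1 through
   8.1.1 (i), 8.1.2 and dimensions): `U(y) = ∏_{i ∈ l} u_i(𝔾ₐ)` for a regular coweight `y`;
3. `zdim_eq_rank_add_card_roots_of_lieWeightSpace_one_le` (`RootSpaceLine.lean`; 8.1.3 (ii)):
   `dim G = dim T + |R|`;
4. `bigCell_nhds_one_of_zdim` (`BigCellOpen.lean`; 8.3.11 from 8.1.3 (ii) by a tangent-space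
   dimension count): `Ω = U(-y) T U(y)` contains a principal open neighbourhood of `1` in `G`;
5. `nonempty_bigCellChart_of_eq_prod` (`RootProductRetraction.lean` with `BigCellReduction.lean`;
   the regularity of the inverse of `U⁻ × T × U → Ω`, Springer's appeal to 5.3.2 (iii) in
   8.3.6 (ii), replaced by the Gauss decomposition in `GL_n` and the polynomial retraction of
   `x ↦ ∏ u_i(x_i)`).

No new named fact is introduced; the statement of `nonempty_bigCellChart` is unchanged.

## References

* T. A. Springer, *Linear Algebraic Groups*, 2nd ed., Progress in Mathematics 9, Birkhäuser
  (1998) [SpringerLAG1998]: 5.4.7, 7.6.4 (ii), 8.1.1 (i), 8.1.2, 8.1.3 (ii), 8.2.1, 8.3.6 (ii),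
  8.3.9, 8.3.11, and the proof of 9.6.2.
* J. E. Humphreys, *Linear Algebraic Groups*, GTM 21, Springer (1975), §28.5 (the big cell).
-/

noncomputable section

open scoped MatrixGroups IsMulCommutative

namespace Literature.NumberTheory.Automorphic

variable {k : Type*} [Field k] {n : Type*} [Fintype n] [DecidableEq n]
variable {ι X Y : Type*} [AddCommGroup X] [AddCommGroup Y]
variable {G T : Subgroup (GL n k)} [IsMulCommutative ↥T]

/-- **The open big cell (Springer 8.3.6 (ii), 8.3.11 with 8.2.1): the named fact
`nonempty_bigCellChart` holds.** For `G ≤ GL_n` connected reductive over an algebraically closed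
field of characteristic `0`, `T` a maximal torus with root datum `P` and root homomorphisms `u_i`
of all roots `α_i`, there is a `BigCellChart G T u`: an open neighbourhood
`Ω = G ∩ ⋃_{d ∈ D} {d ≠ 0}` of `1` and functions `x_i, y_i` (regular on each `G ∩ {d ≠ 0}`) and
`t` (values in `T`, regular coordinates) with `g = ∏_{i ∈ Lneg} u_i(x_i(g)) · t(g) ·
∏_{i ∈ Lpos} u_i(y_i(g))` for `g ∈ Ω`. Proof: `𝔤^T ⊆ L(T)` (5.4.7, 7.6.4 (ii),
`lieWeightSpace_one_le_lieAlgebraGL_holds`) gives the product structure 8.2.1 of `U(y)`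
(`posRootGroup_eq_prod_of_lieWeightSpace_one_le`) and the dimension formula 8.1.3 (ii)
(`zdim_eq_rank_add_card_roots_of_lieWeightSpace_one_le`), hence the openness 8.3.11 of the big
cell (`bigCell_nhds_one_of_zdim`); the regular inverse chart is then
`nonempty_bigCellChart_of_eq_prod`. [cite: SpringerLAG1998, 8.3.6 (ii), 8.3.11 with 8.2.1] -/
theorem nonempty_bigCellChart_holds :
    nonempty_bigCellChart (k := k) (ι := ι) (X := X) (Y := Y) (G := G) (T := T) := by
  intro _ _ hG hT P eX eY h u hu
  have h0 : lieWeightSpace_one_le_lieAlgebraGL G T := lieWeightSpace_one_le_lieAlgebraGL_holds G T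
  exact nonempty_bigCellChart_of_eq_prod (posRootGroup_eq_prod_of_lieWeightSpace_one_le h0)
    (bigCell_nhds_one_of_zdim (zdim_eq_rank_add_card_roots_of_lieWeightSpace_one_le h0)) hG hT h u hu

end Literature.NumberTheory.Automorphic

end
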